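import Summits.CriticalPhenomena.Ising3DConformalLimit.Theorems.PrecisionLaplacianStableConeRPRigidityPeriodicTypeLiouville

/-!
# Stub `stub_periodicTypeLiouville` (S3) for the line `xray-mellin-transfer` of `HRP2Rigidity`

Crux `HyperoctahedralRP.HRP2Rigidity` (stmt-CriticalPhenomena-1979), line `xray-mellin-transfer`,
registered stub `stub_periodicTypeLiouville`: a `T`-periodic entire `G` with
`‖G ω‖ ≤ C e^{β |im ω|}`, `0 ≤ β`, `β T < 2π`, is constant (Liouville for periodic entire
functions of small exponential type; sharp: `cos`, `βT = 2π`).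

RUNNING LOG. The identical statement is registered under the same stub name on the sibling crux
`PrecisionLaplacian.StableConeRPRigidity` (stmt-CriticalPhenomena-4800) and was landed there
first (`Theorems/PrecisionLaplacianStableConeRPRigidityPeriodicTypeLiouville.lean`, proof =
`Literature.Analysis.Complex.apply_eq_apply_of_periodic_of_norm_le_exp`: line-independence of
the Fourier–Laurent coefficient integrals, Fourier uniqueness on `AddCircle T`, identity
theorem). Following the line's no-duplication rule this file does NOT re-prove it: the theorem
below, in this crux's namespace, is the sibling theorem (binder-for-binder identical statement).
An independent sorry-free proof by the substitution `ζ = e^{2πiω/T}` (removable singularity at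
`0` + Cauchy estimate on large circles) is kept in the lead's folder
(`work/stubs/PeriodicTypeLiouville_fullproof_v1.lean`) and is deliberately not landed.
-/

namespace Summit.CriticalPhenomena.Ising3DConformalLimit.Cruxes.HRP2Rigidity.XRayMellin

/-- Registered stub `stub_periodicTypeLiouville` — **S3 · Liouville for periodic entire functions
of small exponential type.** An entire `T`-periodic `G` (`T > 0`) with `‖G ω‖ ≤ C e^{β|Im ω|}`,
`0 ≤ β`, `βT < 2π`, is constant. This is the sibling crux's landed theorem
`Cruxes.StableConeRPRigidity.EntireProfileNullGrowth.stub_periodicTypeLiouville` (same registered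
statement), itself `Literature.Analysis.Complex.apply_eq_apply_of_periodic_of_norm_le_exp`.
[folklore] -/
theorem stub_periodicTypeLiouville :
    ∀ (G : ℂ → ℂ) (T β C : ℝ), 0 < T → 0 ≤ β → β * T < 2 * Real.pi → Differentiable ℂ G →
      (∀ ω : ℂ, G (ω + T) = G ω) → (∀ ω : ℂ, ‖G ω‖ ≤ C * Real.exp (β * |ω.im|)) →
      ∀ z w : ℂ, G z = G w :=
  StableConeRPRigidity.EntireProfileNullGrowth.stub_periodicTypeLiouville

end Summit.CriticalPhenomena.Ising3DConformalLimit.Cruxes.HRP2Rigidity.XRayMellin
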